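import Summits.ResolutionOfSingularities.ResolutionOfSingularities.Theorems.HilbertSamuelEliminationSigmaMaxModificationsCorridor3WLadderBirthForms
import HarnessLib

/-!
# [OURS · L1 W4.2] ROUND-4 BIRTH LAW — the FORMS, part 2/2: `birthNear : BirthNear`
# (cell res-hironaka, LADDER-RESOLUTION rung L; slot W4.2, crux chain w42 `SigmaMaxModificationsCorridor3`
# stmt-ResolutionOfSingularities-19249; `--supports stmt-ResolutionOfSingularities-19249 --as helper`)

PROVENANCE. Part 2 of the companion of `…Corridor3WLadderBirthDefs.lean` (p505417; idea-1's §8 of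
`L/res-L1-w42-idea-1/Sketch-L1-idea-1-C3.lean` sha16 `ea42ede6917f0ca2`), res-L1-w42-plan-1 RULINGS v3.9-2 (I) / v3.9-3 (K),
res-plan-2 D→L MAP v1.15a; split from part 1 (`…BirthForms.lean`: §A–§D, `birthTidy`, res-type-067's handover) only because the
gate caps Theorems files with proofs at 400 lines. This part (§E) is res-D-pv-002's. Everything is OURS (elementary
`MvPolynomial` algebra over a field; the tree's proved point-blow-up chart / translation API only; no scheme, no `Literature.…`
named fact, never a `Theses/…` import); NOT a statement of Hironaka's manuscript [Hironaka2017]. AI-written; no expert review;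
AI review is weaker than expert review.

## What is proved (§E)

**`birthNear : BirthNear`** — one coefficient, one chart of one point blow-up: if `c′·U_j^{m−i} = χ_j(c)` for the `U_j`-chart
substitution `χ_j : U_j ↦ U_j, U_l ↦ U_j U_l` and `c′` vanishes to order `m − i` at a point `b` of the exceptional divisor
(`b_j = 0`), then the degree-`d` form `in_d(c)` vanishes to order `2(m − i) − d` at `b̂ = (b, b_j := 1)`. Route (SHEAR to
`b = 0`): `aeval_chart_eq_chartTransform` (`χ_j` IS the tree's `PointBlowup.chartTransform 0 j`: `U^a ↦ U^{a.update j |a|}` with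
the same coefficient), `translate_aeval_chart` (`(c ∘ χ_j)(U + b) = (c ∘ s_b) ∘ χ_j` for the linear shear
`s_b : U_l ↦ U_l + b_l U_j`), `lowOrder_mul_X_pow` (so `χ_j(c ∘ s_b) = c′(U + b)·U_j^{m−i}` has order `≥ 2(m − i)`),
`HauserPerlega2024.coeff_chartExponent_chartTransform` + `PointBlowup.degree_chartExponent` (every monomial `U^a` of the
degree-`d` form of `c ∘ s_b` has `Σ_{l ≠ j} a_l ≥ 2(m − i) − d`), `lowOrder_translate_single_of_erase_degree` (hence it vanishes
to that order at `e_j`), `translate_single_aeval_shear` + `aeval_unshear_aeval_shear` (the shear is linear, commutes with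
homogeneous components — `EdgeAlgebra.homogeneousComponent_aeval_linear` — and conjugates `U ↦ U + e_j` to `U ↦ U + b̂`). The
hypotheses `∀ n < d, homogeneousComponent n c = 0`, `i < m`, `m − i ≤ d` of `BirthNear` are not used (the chart identity already
forces what is needed) — harmless, recorded for idea-1. Reference (context only): H. Hauser, Bull. AMS 47 (2010) §F (chart
expressions of a point blow-up).
-/

noncomputable section

set_option linter.dupNamespace false

namespace Summit.ResolutionOfSingularities.ResolutionOfSingularities.Theorems.SigmaMaxModificationsCorridor3.Birth

open MvPolynomial Finset
open Literature.AlgebraicGeometry.Resolution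
open Literature.AlgebraicGeometry.Resolution.PointBlowup (translate)
open Literature.AlgebraicGeometry.Resolution.WeightedBlowup
open Literature.AlgebraicGeometry.Hironaka2017.EdgeAlgebra (isHomogeneous_aeval_linear homogeneousComponent_aeval_linear)

/-! ## §E. `BirthNear` -/

section Near

open Literature.AlgebraicGeometry.Resolution.PointBlowup (chartTransform chartExponent degree_chartExponent)
open Literature.AlgebraicGeometry.Resolution.HauserPerlega2024 (chartTransform_monomial chartTransform_add
  coeff_chartExponent_chartTransform)

variable {σ : Type*} {K : Type*} [Field K] [DecidableEq σ]

/-- The `U_j`-chart substitution `U_j ↦ U_j`, `U_l ↦ U_j·U_l` on a monomial: `U^a ↦ U_j^{|a|}·∏_{l ≠ j} U_l^{a_l}`, i.e. the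
monomial with exponent `chartExponent 0 j a = a.update j |a|`. [folklore] -/
theorem aeval_chart_monomial (j : σ) (a : σ →₀ ℕ) (r : K) :
    aeval (fun l => if l = j then (X j : MvPolynomial σ K) else X j * X l) (monomial a r) =
      monomial (chartExponent 0 j a) r := by
  rw [aeval_monomial, algebraMap_eq]
  have hsplit : (fun l e => (if l = j then (X j : MvPolynomial σ K) else X j * X l) ^ e) =
      fun l e => X j ^ e * (if l = j then (1 : MvPolynomial σ K) else X l) ^ e := by
    funext l e
    split_ifs with h
    · rw [one_pow, mul_one]
    · rw [mul_pow]
  have h1 : a.prod (fun _ e => (X j : MvPolynomial σ K) ^ e) = X j ^ a.degree := by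
    rw [Finsupp.prod, Finset.prod_pow_eq_pow_sum, Finsupp.degree_apply]
  have h2 : a.prod (fun l e => (if l = j then (1 : MvPolynomial σ K) else X l) ^ e) =
      (a.erase j).prod (fun l e => (X l : MvPolynomial σ K) ^ e) := by
    rw [Finsupp.prod, Finsupp.prod, Finsupp.support_erase,
      ← Finset.prod_erase a.support (f := fun l => (if l = j then (1 : MvPolynomial σ K) else X l) ^ a l)
        (a := j) (by simp only [↓reduceIte, one_pow])]
    refine Finset.prod_congr rfl fun l hl => ?_
    rw [if_neg (Finset.ne_of_mem_erase hl), Finsupp.erase_ne (Finset.ne_of_mem_erase hl)]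
  have h3 : (a.erase j).prod (fun l e => (X l : MvPolynomial σ K) ^ e) = monomial (a.erase j) 1 := by
    rw [monomial_eq, C_1, one_mul]
  have hexp : chartExponent 0 j a = Finsupp.single j a.degree + a.erase j := by
    unfold chartExponent
    rw [Nat.sub_zero, Finsupp.update_eq_erase_add_single, add_comm]
  rw [hsplit, Finsupp.prod_mul, h1, h2, h3, X_pow_eq_monomial, monomial_mul, one_mul, C_mul_monomial, mul_one, hexp]

/-- The `U_j`-chart substitution is the tree's chart transform with `q = 0` (no division). [folklore] -/
theorem aeval_chart_eq_chartTransform (j : σ) (G : MvPolynomial σ K) :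
    aeval (fun l => if l = j then (X j : MvPolynomial σ K) else X j * X l) G = chartTransform 0 j G := by
  induction G using MvPolynomial.induction_on' with
  | monomial a r => rw [aeval_chart_monomial, chartTransform_monomial]
  | add p q hp hq => rw [map_add, hp, hq, chartTransform_add]

/-- **Translation intertwines the chart with the SHEAR**: for a point `b` of the exceptional divisor (`b_j = 0`),
`(c ∘ χ_j)(U + b) = (c ∘ s_b) ∘ χ_j` with the linear shear `s_b : U_l ↦ U_l + b_l U_j` (`l ≠ j`), `U_j ↦ U_j`. [folklore] -/
theorem translate_aeval_chart (j : σ) (b : σ → K) (hbj : b j = 0) (c : MvPolynomial σ K) :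
    translate b (aeval (fun l => if l = j then (X j : MvPolynomial σ K) else X j * X l) c) =
      aeval (fun l => if l = j then (X j : MvPolynomial σ K) else X j * X l)
        (aeval (fun l => if l = j then (X j : MvPolynomial σ K) else X l + C (b l) * X j) c) := by
  have hfun : (fun l => aeval (fun i => (X i + C (b i) : MvPolynomial σ K))
        ((fun l => if l = j then (X j : MvPolynomial σ K) else X j * X l) l)) =
      fun l => aeval (fun l => if l = j then (X j : MvPolynomial σ K) else X j * X l)
        ((fun l => if l = j then (X j : MvPolynomial σ K) else X l + C (b l) * X j) l) := by
    funext l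
    by_cases hl : l = j
    · simp only [hl, ↓reduceIte, aeval_X, hbj, map_zero, add_zero]
    · simp only [if_neg hl, map_mul, map_add, aeval_X, aeval_C, algebraMap_eq, ↓reduceIte, hbj, map_zero, add_zero]
      ring
  rw [translate_eq_aeval, ← AlgHom.comp_apply, comp_aeval, ← AlgHom.comp_apply, comp_aeval, hfun]

/-- **Translation to `e_j` after the shear = shear after translation to `b̂ = (b, b_j := 1)`.** [folklore] -/
theorem translate_single_aeval_shear (j : σ) (b : σ → K) (P : MvPolynomial σ K) :
    translate (Pi.single j 1) (aeval (fun l => if l = j then (X j : MvPolynomial σ K) else X l + C (b l) * X j) P) =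
      aeval (fun l => if l = j then (X j : MvPolynomial σ K) else X l + C (b l) * X j)
        (translate (Function.update b j 1) P) := by
  have hfun : (fun l => aeval (fun i => (X i + C ((Pi.single j (1 : K) : σ → K) i) : MvPolynomial σ K))
        ((fun l => if l = j then (X j : MvPolynomial σ K) else X l + C (b l) * X j) l)) =
      fun l => aeval (fun l => if l = j then (X j : MvPolynomial σ K) else X l + C (b l) * X j)
        ((fun i => (X i + C (Function.update b j 1 i) : MvPolynomial σ K)) l) := by
    funext l
    by_cases hl : l = j
    · simp only [hl, ↓reduceIte, aeval_X, map_add, aeval_C, algebraMap_eq, Pi.single_eq_same, Function.update_self]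
    · simp only [if_neg hl, map_mul, map_add, aeval_X, aeval_C, algebraMap_eq, Pi.single_eq_same,
        Pi.single_eq_of_ne hl, Function.update_of_ne hl, map_zero, add_zero, map_one]
      ring
  rw [translate_eq_aeval, translate_eq_aeval, ← AlgHom.comp_apply, comp_aeval, ← AlgHom.comp_apply, comp_aeval, hfun]

/-- The shear is undone by the opposite shear. [folklore] -/
theorem aeval_unshear_aeval_shear (j : σ) (b : σ → K) (P : MvPolynomial σ K) :
    aeval (fun l => if l = j then (X j : MvPolynomial σ K) else X l - C (b l) * X j)
      (aeval (fun l => if l = j then (X j : MvPolynomial σ K) else X l + C (b l) * X j) P) = P := by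
  have hfun : (fun l => aeval (fun l => if l = j then (X j : MvPolynomial σ K) else X l - C (b l) * X j)
      ((fun l => if l = j then (X j : MvPolynomial σ K) else X l + C (b l) * X j) l)) = fun l => (X l : MvPolynomial σ K) := by
    funext l
    by_cases hl : l = j
    · simp only [hl, ↓reduceIte, aeval_X]
    · simp only [if_neg hl, map_mul, map_add, aeval_X, aeval_C, algebraMap_eq, ↓reduceIte]
      ring
  rw [← AlgHom.comp_apply, comp_aeval, hfun, aeval_X_left, AlgHom.id_apply]

/-- The shear's letters are linear forms. [folklore] -/
theorem isHomogeneous_shear (j : σ) (b : σ → K) (l : σ) :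
    ((fun l => if l = j then (X j : MvPolynomial σ K) else X l + C (b l) * X j) l).IsHomogeneous 1 := by
  by_cases hl : l = j
  · simp only [hl, ↓reduceIte]; exact isHomogeneous_X _ _
  · simp only [if_neg hl]; exact (isHomogeneous_X _ _).add (isHomogeneous_C_mul_X _ _)

/-- The opposite shear's letters are linear forms. [folklore] -/
theorem isHomogeneous_unshear (j : σ) (b : σ → K) (l : σ) :
    ((fun l => if l = j then (X j : MvPolynomial σ K) else X l - C (b l) * X j) l).IsHomogeneous 1 := by
  by_cases hl : l = j
  · simp only [hl, ↓reduceIte]; exact isHomogeneous_X _ _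
  · simp only [if_neg hl]; exact (isHomogeneous_X _ _).sub (isHomogeneous_C_mul_X _ _)

omit [DecidableEq σ] in
/-- Multiplying by `U_j^q` raises low-order vanishing by `q`. [folklore] -/
theorem lowOrder_mul_X_pow (j : σ) (q : ℕ) {P : MvPolynomial σ K} {μ : ℕ}
    (h : ∀ β : σ →₀ ℕ, β.degree < μ → coeff β P = 0) :
    ∀ β : σ →₀ ℕ, β.degree < μ + q → coeff β (P * X j ^ q) = 0 := by
  intro β hβ
  rw [X_pow_eq_monomial, coeff_mul_monomial']
  split_ifs with hle
  · have hdeg : (β - Finsupp.single j q).degree < μ := by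
      have h1 := congrArg Finsupp.degree (tsub_add_cancel_of_le hle)
      rw [map_add, Finsupp.degree_single] at h1
      omega
    rw [h _ hdeg, zero_mul]
  · rfl

variable [Fintype σ]

/-- A form all of whose monomials `U^a` have `Σ_{l ≠ j} a_l ≥ N` vanishes to order `N` at `e_j`: the translated monomial
`(U_j + 1)^{a_j} ∏_{l≠j} U_l^{a_l}` only produces exponents `β` with `β_l = a_l` off `j`. [folklore] -/
theorem lowOrder_translate_single_of_erase_degree (j : σ) {G : MvPolynomial σ K} {N : ℕ}
    (hG : ∀ a ∈ G.support, N ≤ (a.erase j).degree) :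
    ∀ β : σ →₀ ℕ, β.degree < N → coeff β (translate (Pi.single j 1) G) = 0 := by
  intro β hβ
  rw [PointBlowup.translate_eq_sum_support, coeff_sum]
  refine Finset.sum_eq_zero fun a ha => ?_
  -- some letter `l ≠ j` has `β_l < a_l`
  have hex : ∃ l, l ≠ j ∧ β l < a l := by
    by_contra hne
    push Not at hne
    have hle : a.erase j ≤ β := by
      intro l
      by_cases hl : l = j
      · rw [hl, Finsupp.erase_same]; exact Nat.zero_le _
      · rw [Finsupp.erase_ne hl]; exact hne l hl
    have h1 := Finsupp.degree_mono hle
    have h2 := hG a ha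
    omega
  obtain ⟨l, hl, hlt⟩ := hex
  exact coeff_translate_monomial_eq_zero_of_apply_eq_zero _ a β _ (by rw [Pi.single_apply, if_neg hl]) hlt

/-- **`BirthNear` holds** (every field). SHEAR to the point `b = 0`: with the linear shear `s_b : U_l ↦ U_l + b_l U_j`,
`(c ∘ χ_j)(U + b) = (c ∘ s_b) ∘ χ_j` (`b_j = 0`), so `G := c ∘ s_b` has `G ∘ χ_j = c'(U + b)·U_j^q` of order `≥ 2q` at the
origin (`q = m − i`); `χ_j` carries the monomial `U^a` of `G` to `U^{a.update j |a|}` with the same coefficient (the tree's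
`chartTransform 0 j`), whence every monomial `U^a` of the degree-`d` form `G_d = in_d(c) ∘ s_b` has `Σ_{l≠j} a_l ≥ 2q − d`, i.e.
`G_d` vanishes to order `2q − d` at `e_j`; un-shearing (`s_b` is linear and commutes with translations `e_j ↔ b̂` and with
homogeneous components) gives the claim at `b̂ = (b, b_j := 1)`. The order hypothesis on `c` and `i < m`, `m − i ≤ d` are not
needed. [folklore] -/
theorem birthNear : BirthNear := by
  intro k _ m i d j b c c' _him _hqd hbj _hc heq hvan
  classical
  -- (1) `χ_j(c ∘ s_b) = c'(U + b)·U_j^q` has no monomials of degree `< 2q`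
  have hv : ∀ β : Fin 3 →₀ ℕ, β.degree < m - i → coeff β (translate b c') = 0 :=
    (forall_homogeneousComponent_eq_zero_iff _ _).mp hvan
  have hT : translate b c' * X j ^ (m - i) = chartTransform 0 j
      (aeval (fun l => if l = j then (X j : MvPolynomial (Fin 3) k) else X l + C (b l) * X j) c) := by
    rw [← aeval_chart_eq_chartTransform, ← translate_aeval_chart j b hbj c, ← heq,
      translate_eq_aeval b (c' * X j ^ (m - i)), map_mul, map_pow, aeval_X, hbj, map_zero, add_zero]
    rfl
  have h1 : ∀ β : Fin 3 →₀ ℕ, β.degree < (m - i) + (m - i) → coeff β (chartTransform 0 j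
      (aeval (fun l => if l = j then (X j : MvPolynomial (Fin 3) k) else X l + C (b l) * X j) c)) = 0 := by
    rw [← hT]; exact lowOrder_mul_X_pow j (m - i) hv
  -- (2) exponent bound on the monomials of the degree-`d` form of `c ∘ s_b`
  have h2 : ∀ a ∈ (homogeneousComponent d
      (aeval (fun l => if l = j then (X j : MvPolynomial (Fin 3) k) else X l + C (b l) * X j) c)).support,
      2 * (m - i) - d ≤ (a.erase j).degree := by
    intro a ha
    rw [mem_support_iff, coeff_homogeneousComponent] at ha
    split_ifs at ha with hadeg
    · have haG := mem_support_iff.mpr ha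
      have hne := ha
      rw [← coeff_chartExponent_chartTransform 0 j (fun _ _ => Nat.zero_le _) haG] at hne
      have hge : (m - i) + (m - i) ≤ (chartExponent 0 j a).degree := not_lt.mp fun hlt => hne (h1 _ hlt)
      rw [degree_chartExponent, Nat.sub_zero] at hge
      have hsplit : (a.erase j).degree + a j = a.degree := by
        have h := congrArg Finsupp.degree (Finsupp.erase_add_single j a)
        rwa [map_add, Finsupp.degree_single] at h
      omega
    · exact absurd rfl ha
  -- (3) hence that form vanishes to order `2q − d` at `e_j`; (4) rewrite through the shear; (5) un-shear
  have h3 := lowOrder_translate_single_of_erase_degree j h2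
  rw [homogeneousComponent_aeval_linear _ (isHomogeneous_shear j b), translate_single_aeval_shear] at h3
  intro n hn
  have hP := (forall_homogeneousComponent_eq_zero_iff _ _).mpr h3 n hn
  have h5 := congrArg (aeval (fun l => if l = j then (X j : MvPolynomial (Fin 3) k) else X l - C (b l) * X j)) hP
  rw [map_zero, ← homogeneousComponent_aeval_linear _ (isHomogeneous_unshear j b), aeval_unshear_aeval_shear] at h5
  exact h5

end Near

end Summit.ResolutionOfSingularities.ResolutionOfSingularities.Theorems.SigmaMaxModificationsCorridor3.Birth

end
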